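import Mathlib

/-!
# Route BarrierLever — conjecture CT (`TransversalResultantKernelNonsingular`, stmt-ValiantsHypothesis-19179):
# GENERAL VALUATION CERTIFICATES (arbitrary tree-metric degenerations, one table for a whole height)

Cell valiant-natproofs, rung V4, 𝒟-side door (c); prover seat val-np-p7 (g2). `--supports`
stmt-ValiantsHypothesis-19179 (CT ⇒ TT 19152 ⇒ TNS 19126 ⇒ 19717; TT ⇒ the irreducible core 19616
trivially). Closes NO item.

**What is new relative to `…TransversalResultantKernelNonsingularTropical`.** That file certifies a
CT layout minor `det (∏_{a,c} (p (ρ_{u_i} a) − q (τ_{w_j} c)))_{i,j} ≠ 0` from a unique optimal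
assignment for the valuation pattern of a CHERRY FOREST (`μ : ι → Option κ`: the row parameter `p_i`
collides with at most one column parameter `q_{μ i}`, to order `wt i`; every other difference has
valuation `0`). Here the degeneration is ARBITRARY: the certificate supplies one-parameter families
`pP : ι → ℂ[X]`, `qP : κ → ℂ[X]` and a valuation table `d : ι → κ → ℕ` with
`pP i − qP k = X ^ (d i k) · g i k`, `g i k (0) ≠ 0` (exact `X`-adic valuations of ALL cross
differences — e.g. the lca-depth table of any rooted tree with the `p`'s and `q`'s at its leaves,
realised by digit expansions along root paths), and the block order is
`ord i j = Σ_{a,c} d (R i a) (S j c)`.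

* `det_resultantMatrix_ne_zero_of_valuation` — resultant-type matrices
  `M[i,j] = ∏_{a,c} (p (R i a) − q (S j c))`: a unique minimiser of `σ ↦ Σ_j ord (σ j) j` forces
  `det M ≠ 0` at some complex point (leading `X`-coefficient of `det` over `ℂ[X]` is
  `± ∏_j G_{π₀ j, j}(0) ≠ 0`).
* `resultantKernel_layout_ne_zero_of_valuation` — the CT-shaped instance (one layout).
* `resultantKernel_slice_of_universal_valuation` — ONE table for a whole height: if a single
  valuation certificate `(pP, qP, d)` on the `2h + 2h` literals gives every pair of injective
  layouts `u w : Fin r → Finset (Fin h)` (all `r`) a unique optimal assignment, then the entire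
  height-`h` slice of CT holds.

**Why (evidence, this seat, 2026-08-27).** Writing `P⁺_a/P⁻_a` for the row literals of coordinate
`a` and `Q⁺_c/Q⁻_c` for the column literals, the block order is, modulo terms depending on the row
or on the column alone, the bilinear form `1_uᵀ D 1_w` with
`D_{ac} = d(P⁺_a,Q⁺_c) + d(P⁻_a,Q⁻_c) − d(P⁺_a,Q⁻_c) − d(P⁻_a,Q⁺_c)`; for the FREE table the strictly
Monge choice certifies every layout (`…FreePairKernelNonsingular`), and the content of CT is which
`D` are realisable by valuations. Exhaustive check at `h = 3`: the plain monomial table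
`p_k = X^{v_k}`, `q_l = X^{v'_l}` with literal order (increasing valuation)
`Q⁺₁ P⁺₂ Q⁻₂ P⁻₀ P⁺₁ Q⁺₂ Q⁺₀ P⁻₂ P⁺₀ Q⁻₀ Q⁻₁ P⁻₁` and `v = 64^position` gives a UNIQUE optimal
assignment for ALL 12 805 pairs of equal-size families of subsets of `{0,1,2}` (two independent
checkers), i.e. one certificate for the whole `h = 3` slice of CT; at `h = 4` monomial (caterpillar)
tables cannot even separate all `2 × 2` exchanges, while general tree tables pass every `2 × 2` and
`3 × 3` layout and all but `≈ 2·10⁻⁴` of sampled larger ones (kit jobs j267105/j267109 on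
stmt-19616 search for a universal `h = 4` tree). This file is the kernel door such a table goes
through.

WHAT THIS IS NOT: no layout is certified here and no item closes; CT/TT/TNS/19616/19717 remain open
for general `h`; nothing on crux 14610 or `VP ≠ VNP`.
-/

-- layout Summits/ValiantsHypothesis/ValiantsHypothesis forces the duplicated namespace component
set_option linter.dupNamespace false

open Polynomial Finset

namespace Summit.ValiantsHypothesis.ValiantsHypothesis.Theorems.BarrierLever.ResultantKernel

/-! ## 1. General valuation certificates for resultant-type matrices -/

/-- **Unique optimal assignment ⇒ nonzero determinant**, for an ARBITRARY valuation pattern.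
`M[i,j] = ∏_{a,c} (p (R i a) - q (S j c))`; the certificate is a pair of polynomial families
`pP, qP` over `ℂ` whose cross differences have exact `X`-adic valuations `d i k`
(`pP i - qP k = X ^ d i k * g i k`, `(g i k).eval 0 ≠ 0`), together with a unique minimiser `π₀` of
`σ ↦ Σ_j ord (σ j) j`, `ord i j = Σ_{a,c} d (R i a) (S j c)`. Then `det M ≠ 0` at some complex
parameters (namely `p = pP (z)`, `q = qP (z)` for a non-root `z` of `det M(X)`). -/
theorem det_resultantMatrix_ne_zero_of_valuation
    {ι κ α γ : Type*} [Fintype α] [Fintype γ] {r : ℕ}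
    (R : Fin r → α → ι) (S : Fin r → γ → κ)
    (pP : ι → ℂ[X]) (qP : κ → ℂ[X]) (d : ι → κ → ℕ) (g : ι → κ → ℂ[X])
    (hfac : ∀ i k, pP i - qP k = X ^ d i k * g i k) (hg0 : ∀ i k, (g i k).eval 0 ≠ 0)
    (ord : Fin r → Fin r → ℕ) (hord : ∀ i j, ord i j = ∑ a, ∑ c, d (R i a) (S j c))
    (π₀ : Equiv.Perm (Fin r))
    (huniq : ∀ σ : Equiv.Perm (Fin r), σ ≠ π₀ → ∑ j, ord (π₀ j) j < ∑ j, ord (σ j) j) :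
    ∃ p : ι → ℂ, ∃ q : κ → ℂ,
      (Matrix.of fun i j : Fin r => ∏ a, ∏ c, (p (R i a) - q (S j c))).det ≠ 0 := by
  classical
  -- the matrix over `ℂ[X]` and its entries
  set Mε : Matrix (Fin r) (Fin r) ℂ[X] :=
    Matrix.of fun i j => ∏ a, ∏ c, (pP (R i a) - qP (S j c)) with hMε
  set G : Fin r → Fin r → ℂ[X] := fun i j => ∏ a, ∏ c, g (R i a) (S j c) with hG
  have hentry : ∀ i j, Mε i j = X ^ ord i j * G i j := by
    intro i j
    rw [hMε, Matrix.of_apply, hord i j, hG]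
    simp only
    simp_rw [hfac]
    simp_rw [Finset.prod_mul_distrib, Finset.prod_pow_eq_pow_sum]
  have hG0 : ∀ i j, (G i j).eval 0 ≠ 0 := by
    intro i j
    rw [hG]
    simp only [eval_prod]
    exact Finset.prod_ne_zero_iff.2 fun a _ => Finset.prod_ne_zero_iff.2 fun c _ => hg0 _ _
  -- the coefficient of `X^{cost π₀}` in `det Mε`
  set m₀ : ℕ := ∑ j, ord (π₀ j) j with hm₀
  have hcoeff : Mε.det.coeff m₀ =
      ((Equiv.Perm.sign π₀ : ℤ) : ℂ) * ∏ j, (G (π₀ j) j).eval 0 := by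
    rw [Matrix.det_apply', finsetSum_coeff]
    rw [Finset.sum_eq_single π₀]
    · rw [show (((Equiv.Perm.sign π₀ : ℤ)) : ℂ[X]) = C ((Equiv.Perm.sign π₀ : ℤ) : ℂ) from
        (map_intCast (Polynomial.C : ℂ →+* ℂ[X]) _).symm, coeff_C_mul]
      congr 1
      simp_rw [hentry]
      rw [Finset.prod_mul_distrib, Finset.prod_pow_eq_pow_sum, coeff_X_pow_mul',
        if_pos (le_of_eq hm₀.symm), hm₀, Nat.sub_self, coeff_zero_eq_eval_zero, eval_prod]
    · intro σ _ hσ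
      rw [show (((Equiv.Perm.sign σ : ℤ)) : ℂ[X]) = C ((Equiv.Perm.sign σ : ℤ) : ℂ) from
        (map_intCast (Polynomial.C : ℂ →+* ℂ[X]) _).symm, coeff_C_mul]
      simp_rw [hentry]
      rw [Finset.prod_mul_distrib, Finset.prod_pow_eq_pow_sum, coeff_X_pow_mul',
        if_neg (not_le.2 (huniq σ hσ)), mul_zero]
    · intro h
      exact absurd (Finset.mem_univ π₀) h
  have hdet : Mε.det ≠ 0 := by
    intro hz
    have h1 := hcoeff
    rw [hz, coeff_zero] at h1
    refine mul_ne_zero ?_ (Finset.prod_ne_zero_iff.2 fun j _ => hG0 _ _) h1.symm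
    exact Int.cast_ne_zero.2 (Units.ne_zero _)
  -- a nonzero polynomial over `ℂ` has a non-root: evaluate there
  have hroot : ∃ z : ℂ, Mε.det.eval z ≠ 0 := by
    by_contra hcon
    push Not at hcon
    apply hdet
    refine Polynomial.eq_zero_of_infinite_isRoot _ ?_
    have hall : {x : ℂ | Mε.det.IsRoot x} = Set.univ := Set.eq_univ_of_forall fun x => hcon x
    rw [hall]
    exact Set.infinite_univ
  obtain ⟨z, hz⟩ := hroot
  refine ⟨fun i => (pP i).eval z, fun k => (qP k).eval z, ?_⟩
  have heval : (Matrix.of fun i j : Fin r =>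
      ∏ a, ∏ c, ((pP (R i a)).eval z - (qP (S j c)).eval z)).det = Mε.det.eval z := by
    rw [hMε, ← Polynomial.coe_evalRingHom, RingHom.map_det]
    congr 1
    ext i j
    simp only [RingHom.mapMatrix_apply, Matrix.map_apply, Matrix.of_apply,
      Polynomial.coe_evalRingHom, eval_prod, eval_sub]
  rw [heval]
  exact hz

/-! ## 2. The CT-shaped corollary, one layout -/

/-- **General valuation certificate ⇒ CT for one layout.** For a transversal layout `(u, w)` at
height `h`, polynomial literal parameters `pP qP : Fin (h+h) → ℂ[X]` with exact cross valuations
`d` and a unique minimiser `π₀` of `σ ↦ Σ_j Σ_{a,c} d (ρ_{u_{σ j}} a) (τ_{w_j} c)` give complex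
parameters `p, q` at which the CT layout minor is nonzero. -/
theorem resultantKernel_layout_ne_zero_of_valuation
    (h r : ℕ) (u w : Fin r → Finset (Fin h))
    (pP qP : Fin (h + h) → ℂ[X]) (d : Fin (h + h) → Fin (h + h) → ℕ)
    (g : Fin (h + h) → Fin (h + h) → ℂ[X])
    (hfac : ∀ i k, pP i - qP k = X ^ d i k * g i k) (hg0 : ∀ i k, (g i k).eval 0 ≠ 0)
    (ord : Fin r → Fin r → ℕ)
    (hord : ∀ i j, ord i j = ∑ a : Fin h, ∑ c : Fin h,
      d (if a ∈ u i then Fin.castAdd h a else Fin.natAdd h a)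
        (if c ∈ w j then Fin.natAdd h c else Fin.castAdd h c))
    (π₀ : Equiv.Perm (Fin r))
    (huniq : ∀ σ : Equiv.Perm (Fin r), σ ≠ π₀ → ∑ j, ord (π₀ j) j < ∑ j, ord (σ j) j) :
    ∃ p q : Fin (h + h) → ℂ, (Matrix.of fun i j : Fin r => ∏ a : Fin h, ∏ c : Fin h,
      (p (if a ∈ u i then Fin.castAdd h a else Fin.natAdd h a)
        - q (if c ∈ w j then Fin.natAdd h c else Fin.castAdd h c))).det ≠ 0 :=
  det_resultantMatrix_ne_zero_of_valuation
    (fun i a => if a ∈ u i then Fin.castAdd h a else Fin.natAdd h a)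
    (fun j c => if c ∈ w j then Fin.natAdd h c else Fin.castAdd h c)
    pP qP d g hfac hg0 ord hord π₀ huniq

/-! ## 3. One certificate for a whole height -/

/-- **Universal valuation certificate ⇒ the height-`h` slice of CT.** If ONE valuation certificate
`(pP, qP, d)` on the `2h` row literals and `2h` column literals makes the assignment problem
`σ ↦ Σ_j Σ_{a,c} d (ρ_{u_{σ j}} a) (τ_{w_j} c)` uniquely solvable for EVERY pair of injective
layouts `u w : Fin r → Finset (Fin h)` (every `r`), then CT holds for every such pair at height
`h`. -/
theorem resultantKernel_slice_of_universal_valuation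
    (h : ℕ) (pP qP : Fin (h + h) → ℂ[X]) (d : Fin (h + h) → Fin (h + h) → ℕ)
    (g : Fin (h + h) → Fin (h + h) → ℂ[X])
    (hfac : ∀ i k, pP i - qP k = X ^ d i k * g i k) (hg0 : ∀ i k, (g i k).eval 0 ≠ 0)
    (huniv : ∀ (r : ℕ) (u w : Fin r → Finset (Fin h)), Function.Injective u →
      Function.Injective w → ∃ π₀ : Equiv.Perm (Fin r), ∀ σ : Equiv.Perm (Fin r), σ ≠ π₀ →
        (∑ j, ∑ a : Fin h, ∑ c : Fin h,
          d (if a ∈ u (π₀ j) then Fin.castAdd h a else Fin.natAdd h a)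
            (if c ∈ w j then Fin.natAdd h c else Fin.castAdd h c)) <
        (∑ j, ∑ a : Fin h, ∑ c : Fin h,
          d (if a ∈ u (σ j) then Fin.castAdd h a else Fin.natAdd h a)
            (if c ∈ w j then Fin.natAdd h c else Fin.castAdd h c))) :
    ∀ (r : ℕ) (u w : Fin r → Finset (Fin h)), Function.Injective u → Function.Injective w →
      ∃ p q : Fin (h + h) → ℂ, (Matrix.of fun i j : Fin r => ∏ a : Fin h, ∏ c : Fin h,
        (p (if a ∈ u i then Fin.castAdd h a else Fin.natAdd h a)
          - q (if c ∈ w j then Fin.natAdd h c else Fin.castAdd h c))).det ≠ 0 := by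
  intro r u w hu hw
  obtain ⟨π₀, hπ₀⟩ := huniv r u w hu hw
  exact resultantKernel_layout_ne_zero_of_valuation h r u w pP qP d g hfac hg0
    (fun i j => ∑ a : Fin h, ∑ c : Fin h,
      d (if a ∈ u i then Fin.castAdd h a else Fin.natAdd h a)
        (if c ∈ w j then Fin.natAdd h c else Fin.castAdd h c))
    (fun _ _ => rfl) π₀ hπ₀

/-! ## 4. Monomial (caterpillar) certificates are valuation certificates -/

/-- The plain monomial table `p_k = X^{v k}`, `q_l = X^{v' l}` with `v k ≠ v' l` for all `k, l` is a
valuation certificate with `d k l = min (v k) (v' l)`: `X^a - X^b = X^{min a b} · g`, `g(0) = ±1`. -/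
theorem monomial_valuation_certificate {ι κ : Type*} (v : ι → ℕ) (v' : κ → ℕ)
    (hvv : ∀ i k, v i ≠ v' k) :
    ∃ g : ι → κ → ℂ[X], (∀ i k, (X : ℂ[X]) ^ v i - X ^ v' k = X ^ min (v i) (v' k) * g i k) ∧
      ∀ i k, (g i k).eval 0 ≠ 0 := by
  classical
  refine ⟨fun i k => if v i < v' k then 1 - X ^ (v' k - v i) else X ^ (v i - v' k) - 1, ?_, ?_⟩
  · intro i k
    by_cases hlt : v i < v' k
    · simp only [hlt, if_true, min_eq_left hlt.le, mul_sub, mul_one, ← pow_add,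
        Nat.add_sub_cancel' hlt.le]
    · have hle : v' k ≤ v i := not_lt.1 hlt
      simp only [hlt, if_false, min_eq_right hle, mul_sub, mul_one, ← pow_add,
        Nat.add_sub_cancel' hle]
  · intro i k
    by_cases hlt : v i < v' k
    · have hpos : v' k - v i ≠ 0 := Nat.sub_ne_zero_of_lt hlt
      simp [hlt, hpos]
    · have hne : v i - v' k ≠ 0 := by
        have := hvv i k
        omega
      simp [hlt, hne]

end Summit.ValiantsHypothesis.ValiantsHypothesis.Theorems.BarrierLever.ResultantKernel
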